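import Mathlib.MeasureTheory.Integral.IntervalIntegral.FundThmCalculus
import Mathlib.MeasureTheory.Integral.MeanInequalities
import Mathlib.MeasureTheory.Integral.Average
import Mathlib.MeasureTheory.Measure.Haar.NormedSpace
import Mathlib.MeasureTheory.Measure.Lebesgue.EqHaar
import Mathlib.Analysis.Normed.Module.Convex
import Mathlib.Analysis.InnerProductSpace.PiL2
import Mathlib.Analysis.Calculus.ContDiff.Basic
import Mathlib.Analysis.Calculus.Deriv.Mul
import Mathlib.Analysis.Calculus.Deriv.Add
import Mathlib.Tactic.Module
import HarnessLib

/-!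
# The Poincaré inequality on balls for `C¹` maps

Analysis/FluidPDE support file (serves the discharge of the nonlinear estimate `Y₆` in Tao 2011,
§10, where "the Poincaré inequality" on Whitney balls compares local `L²` averages of the
vorticity, arXiv:1108.1165 p. 32: "To deal with the small balls we use the Poincaré inequality").

Let `E` be a finite-dimensional real inner product space of dimension `n` with its Lebesgue
(Haar) measure, `F` a real Banach space, `f ∈ C¹(E; F)`, `B = B(x₀, r)` an open ball and
`f_B = ⨍_B f` the mean. We prove, in the extended (`ℝ≥0∞`-valued) form that needs no
integrability hypotheses,

  `∫_B ‖f − f_B‖² ≤ 2ⁿ · 4r² · ∫_B ‖Df‖²`      (`lintegral_ball_sub_average_sq_le`).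

Proof (Evans, *PDE*, §5.8.1 Thm. 2 for the statement; the elementary convexity argument of
Gilbarg–Trudinger (7.45) for the proof, arranged so that the Jacobians stay bounded): by Jensen,
`‖f(x) − f_B‖² ≤ ⨍_B ‖f(x) − f(y)‖² dy`; joining `x` and `y` through their midpoint and using the
fundamental theorem of calculus on each half segment and Cauchy–Schwarz,
`‖f(y) − f(x)‖² ≤ |y − x|² (∫₀^{1/2} ‖Df(x + τ(y − x))‖² dτ + ∫₀^{1/2} ‖Df(y + τ(x − y))‖² dτ)`;
for `τ ≤ 1/2` the substitution `x ↦ (1 − τ)x + τy` has Jacobian `(1 − τ)⁻ⁿ ≤ 2ⁿ` and maps `B`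
into `B` (convexity), whence `∫_B ∫_B ∫₀^{1/2} ‖Df(x + τ(y−x))‖² ≤ 2ⁿ⁻¹ |B| ∫_B ‖Df‖²` (Tonelli).

## Mathlib / tree search

Mathlib (this pin) has the Gagliardo–Nirenberg–Sobolev inequality
(`MeasureTheory.eLpNorm_le_eLpNorm_fderiv_of_eq`) but no Poincaré inequality. The TREE does:
`Literature/Analysis/FunctionSpaces/SobolevTracePoincareProofs.lean` proves the Poincaré
inequality on bounded domains star-shaped with respect to a ball, for every `1 ≤ p ≤ ∞`, in
`eLpNorm` form (`Literature.Analysis.FunctionSpaces.poincare_starShaped`,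
`eLpNorm_prod_sub_le_of_contDiff`, `eLpNorm_sub_setAverage_le_of_prod`; Maz'ya §1.1.11), and
discharges Poincaré–Wirtinger on Lipschitz domains (`poincare_wirtinger_holds`); it even contains
the affine substitution `lintegral_comp_smul_add` re-proved below. (Correction of the first
version of this docstring, which overlooked that file: a ball being star-shaped with respect to
itself, the present `p = 2` statement is essentially the special case `A = B = B(x₀, r)` of
`eLpNorm_sub_setAverage_le_of_prod` + `eLpNorm_prod_sub_le_of_contDiff`, with a self-contained
proof and an explicit constant; the real-valued square form used by the `Y₆` chain is in
`FluidPDE/TaoY6Poincare.lean`.) Used here: `intervalIntegral.integral_eq_sub_of_hasDerivAt`,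
`enorm_integral_le_lintegral_enorm`, `ENNReal.lintegral_mul_le_Lp_mul_Lq` (Cauchy–Schwarz),
`Measure.map_addHaar_smul` + `lintegral_add_right_eq_self` (affine substitution),
`lintegral_lintegral_swap` (Tonelli), `convex_ball`.

## References

* L. C. Evans, *Partial Differential Equations*, 2nd ed. (2010), §5.8.1, Thm. 2 (Poincaré's
  inequality on a ball).
* D. Gilbarg, N. S. Trudinger, *Elliptic partial differential equations of second order* (2001),
  (7.45) and Lemma 7.16 (the convexity argument).
* T. Tao, *Localisation and compactness properties of the Navier–Stokes global regularity
  problem*, Anal. PDE 6 (2013) = arXiv:1108.1165, §10, p. 32.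
-/

noncomputable section

open MeasureTheory Set Filter Metric Function Module
open scoped ENNReal NNReal Topology

namespace Literature.Analysis.FluidPDE

namespace PoincareBall

variable {E : Type*} [NormedAddCommGroup E] [InnerProductSpace ℝ E] [FiniteDimensional ℝ E]
  [MeasurableSpace E] [BorelSpace E]
variable {F : Type*} [NormedAddCommGroup F] [NormedSpace ℝ F] [CompleteSpace F]

/-! ### Two elementary `ℝ≥0∞` inequalities -/

/-- Cauchy–Schwarz: `(∫ g)² ≤ μ(univ) ∫ g²` for an a.e.-measurable `g ≥ 0`. [folklore] -/
theorem sq_lintegral_le_measure_mul_lintegral_sq {α : Type*} [MeasurableSpace α] (μ : Measure α)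
    {g : α → ℝ≥0∞} (hg : AEMeasurable g μ) :
    (∫⁻ a, g a ∂μ) ^ 2 ≤ μ univ * ∫⁻ a, g a ^ 2 ∂μ := by
  have h := ENNReal.lintegral_mul_le_Lp_mul_Lq μ Real.HolderConjugate.two_two hg
    (aemeasurable_const (b := (1 : ℝ≥0∞)))
  simp only [Pi.mul_apply, mul_one, ENNReal.one_rpow, lintegral_const, one_mul] at h
  have h2 : ∀ a, g a ^ (2 : ℝ) = g a ^ 2 := fun a => ENNReal.rpow_two _
  simp only [h2] at h
  calc (∫⁻ a, g a ∂μ) ^ 2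
      ≤ ((∫⁻ a, g a ^ 2 ∂μ) ^ (1 / (2 : ℝ)) * μ univ ^ (1 / (2 : ℝ))) ^ 2 :=
        pow_le_pow_left' h 2
    _ = μ univ * ∫⁻ a, g a ^ 2 ∂μ := by
        rw [mul_pow, ← ENNReal.rpow_two, ← ENNReal.rpow_two, ← ENNReal.rpow_mul,
          ← ENNReal.rpow_mul]
        norm_num
        rw [mul_comm]

/-- `(A + B)² ≤ 2A² + 2B²` in `ℝ≥0∞`. [folklore] -/
theorem add_sq_le_two_mul_sq_add (A B : ℝ≥0∞) : (A + B) ^ 2 ≤ 2 * A ^ 2 + 2 * B ^ 2 := by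
  rcases eq_or_ne A ⊤ with rfl | hA
  · simp
  rcases eq_or_ne B ⊤ with rfl | hB
  · simp
  lift A to ℝ≥0 using hA
  lift B to ℝ≥0 using hB
  have h : ((A + B) ^ 2 : ℝ≥0) ≤ 2 * A ^ 2 + 2 * B ^ 2 := by
    rw [← NNReal.coe_le_coe]
    push_cast
    nlinarith [sq_nonneg ((A : ℝ) - B)]
  exact_mod_cast h

/-! ### The fundamental theorem of calculus on a half segment -/

omit [MeasurableSpace E] [BorelSpace E] [FiniteDimensional ℝ E] [CompleteSpace F] in
/-- Along the segment `τ ↦ a + τ(b − a)` a `C¹` map has derivative `Df(a + τ(b − a))(b − a)`. [folklore] -/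
theorem hasDerivAt_comp_segment {f : E → F} (hf : ContDiff ℝ 1 f) (a b : E) (τ : ℝ) :
    HasDerivAt (fun s : ℝ => f (a + s • (b - a))) (fderiv ℝ f (a + τ • (b - a)) (b - a)) τ := by
  have h1 : HasDerivAt (fun s : ℝ => a + s • (b - a)) (b - a) τ := by
    simpa using HasDerivAt.const_add a (HasDerivAt.smul_const (hasDerivAt_id τ) (b - a))
  have h2 : HasFDerivAt f (fderiv ℝ f (a + τ • (b - a))) (a + τ • (b - a)) :=
    ((hf.differentiable one_ne_zero) _).hasFDerivAt
  exact h2.comp_hasDerivAt τ h1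

omit [MeasurableSpace E] [BorelSpace E] [FiniteDimensional ℝ E] in
/-- **Half-segment FTC bound**: `‖f(a + ½(b − a)) − f(a)‖ₑ ≤ ‖b − a‖ₑ ∫₀^{1/2} ‖Df(a + τ(b − a))‖ₑ dτ`
for `f ∈ C¹`. [folklore] -/
theorem enorm_sub_le_mul_lintegral_half {f : E → F} (hf : ContDiff ℝ 1 f) (a b : E) :
    ‖f (a + (2⁻¹ : ℝ) • (b - a)) - f a‖ₑ ≤
      ‖b - a‖ₑ * ∫⁻ τ in Icc (0 : ℝ) 2⁻¹, ‖fderiv ℝ f (a + τ • (b - a))‖ₑ := by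
  have hcont : Continuous fun s : ℝ => fderiv ℝ f (a + s • (b - a)) (b - a) :=
    ((hf.continuous_fderiv one_ne_zero).comp (by fun_prop)).clm_apply continuous_const
  have hftc := intervalIntegral.integral_eq_sub_of_hasDerivAt
    (fun τ _ => hasDerivAt_comp_segment hf a b τ) (hcont.intervalIntegrable 0 2⁻¹)
  simp only [zero_smul, add_zero] at hftc
  rw [← hftc, intervalIntegral.integral_of_le (by norm_num : (0 : ℝ) ≤ 2⁻¹)]
  calc ‖∫ s in Ioc (0 : ℝ) 2⁻¹, fderiv ℝ f (a + s • (b - a)) (b - a)‖ₑ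
      ≤ ∫⁻ s in Ioc (0 : ℝ) 2⁻¹, ‖fderiv ℝ f (a + s • (b - a)) (b - a)‖ₑ :=
        enorm_integral_le_lintegral_enorm _
    _ ≤ ∫⁻ s in Icc (0 : ℝ) 2⁻¹, ‖fderiv ℝ f (a + s • (b - a)) (b - a)‖ₑ :=
        lintegral_mono_set Ioc_subset_Icc_self
    _ ≤ ∫⁻ s in Icc (0 : ℝ) 2⁻¹, ‖fderiv ℝ f (a + s • (b - a))‖ₑ * ‖b - a‖ₑ :=
        lintegral_mono fun s => ContinuousLinearMap.le_opENorm _ _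
    _ = ‖b - a‖ₑ * ∫⁻ s in Icc (0 : ℝ) 2⁻¹, ‖fderiv ℝ f (a + s • (b - a))‖ₑ := by
        rw [lintegral_mul_const' _ _ enorm_ne_top, mul_comm]

omit [MeasurableSpace E] [BorelSpace E] [FiniteDimensional ℝ E] in
/-- Squared half-segment bound, Cauchy–Schwarz on `[0, 1/2]` (length `1/2`):
`‖f(a + ½(b − a)) − f(a)‖ₑ² ≤ ½ T(a, b)`, where here and below
`T(a, b) = ‖b − a‖ₑ² ∫₀^{1/2} ‖Df(a + τ(b − a))‖ₑ² dτ` is the half-segment energy. [folklore] -/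
theorem enorm_sub_sq_le_halfEnergy {f : E → F} (hf : ContDiff ℝ 1 f) (a b : E) :
    ‖f (a + (2⁻¹ : ℝ) • (b - a)) - f a‖ₑ ^ 2 ≤ 2⁻¹ *
      (‖b - a‖ₑ ^ 2 * ∫⁻ τ in Icc (0 : ℝ) 2⁻¹, ‖fderiv ℝ f (a + τ • (b - a))‖ₑ ^ 2) := by
  have hg : AEMeasurable (fun τ : ℝ => ‖fderiv ℝ f (a + τ • (b - a))‖ₑ)
      (volume.restrict (Icc (0 : ℝ) 2⁻¹)) :=
    ((hf.continuous_fderiv one_ne_zero).comp (by fun_prop)).measurable.enorm.aemeasurable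
  have hcs := sq_lintegral_le_measure_mul_lintegral_sq (volume.restrict (Icc (0 : ℝ) 2⁻¹)) hg
  rw [Measure.restrict_apply_univ, Real.volume_Icc, sub_zero] at hcs
  calc ‖f (a + (2⁻¹ : ℝ) • (b - a)) - f a‖ₑ ^ 2
      ≤ (‖b - a‖ₑ * ∫⁻ τ in Icc (0 : ℝ) 2⁻¹, ‖fderiv ℝ f (a + τ • (b - a))‖ₑ) ^ 2 :=
        pow_le_pow_left' (enorm_sub_le_mul_lintegral_half hf a b) 2
    _ ≤ ‖b - a‖ₑ ^ 2 * (ENNReal.ofReal 2⁻¹ *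
          ∫⁻ τ in Icc (0 : ℝ) 2⁻¹, ‖fderiv ℝ f (a + τ • (b - a))‖ₑ ^ 2) := by
        rw [mul_pow]; gcongr
    _ = _ := by
        rw [ENNReal.ofReal_inv_of_pos two_pos, ENNReal.ofReal_ofNat]; ring

omit [MeasurableSpace E] [BorelSpace E] [FiniteDimensional ℝ E] in
/-- **Two half segments**: `‖f(x) − f(y)‖ₑ² ≤ T(x, y) + T(y, x)`, joining `x` and `y` through the
common midpoint `x + ½(y − x) = y + ½(x − y)`. [folklore] -/
theorem enorm_sub_sq_le_halfEnergy_add {f : E → F} (hf : ContDiff ℝ 1 f) (x y : E) :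
    ‖f x - f y‖ₑ ^ 2 ≤ (‖y - x‖ₑ ^ 2 * ∫⁻ τ in Icc (0 : ℝ) 2⁻¹, ‖fderiv ℝ f (x + τ • (y - x))‖ₑ ^ 2) +
      (‖x - y‖ₑ ^ 2 * ∫⁻ τ in Icc (0 : ℝ) 2⁻¹, ‖fderiv ℝ f (y + τ • (x - y))‖ₑ ^ 2) := by
  have hmid : x + (2⁻¹ : ℝ) • (y - x) = y + (2⁻¹ : ℝ) • (x - y) := by module
  set m := x + (2⁻¹ : ℝ) • (y - x) with hm
  have h1 := enorm_sub_sq_le_halfEnergy hf x y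
  have h2 := enorm_sub_sq_le_halfEnergy hf y x
  rw [← hmid] at h2
  have htri : ‖f x - f y‖ₑ ≤ ‖f m - f x‖ₑ + ‖f m - f y‖ₑ :=
    calc ‖f x - f y‖ₑ = ‖(f m - f y) - (f m - f x)‖ₑ := by congr 1; abel
      _ ≤ ‖f m - f y‖ₑ + ‖f m - f x‖ₑ := enorm_sub_le
      _ = ‖f m - f x‖ₑ + ‖f m - f y‖ₑ := add_comm _ _
  calc ‖f x - f y‖ₑ ^ 2 ≤ (‖f m - f x‖ₑ + ‖f m - f y‖ₑ) ^ 2 := pow_le_pow_left' htri 2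
    _ ≤ 2 * ‖f m - f x‖ₑ ^ 2 + 2 * ‖f m - f y‖ₑ ^ 2 := add_sq_le_two_mul_sq_add _ _
    _ ≤ 2 * (2⁻¹ * (‖y - x‖ₑ ^ 2 * ∫⁻ τ in Icc (0 : ℝ) 2⁻¹, ‖fderiv ℝ f (x + τ • (y - x))‖ₑ ^ 2)) +
        2 * (2⁻¹ * (‖x - y‖ₑ ^ 2 * ∫⁻ τ in Icc (0 : ℝ) 2⁻¹, ‖fderiv ℝ f (y + τ • (x - y))‖ₑ ^ 2)) :=
        add_le_add (mul_le_mul_of_nonneg_left h1 zero_le) (mul_le_mul_of_nonneg_left h2 zero_le)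
    _ = _ := by
        have h22 : ∀ X : ℝ≥0∞, 2 * (2⁻¹ * X) = X := fun X => by
          rw [← mul_assoc, ENNReal.mul_inv_cancel two_ne_zero ENNReal.ofNat_ne_top, one_mul]
        rw [h22, h22]

omit [MeasurableSpace E] [BorelSpace E] [FiniteDimensional ℝ E] [CompleteSpace F] in
/-- Inside a ball of radius `r` the prefactor is at most `4r²`:
`T(a, b) ≤ 4r² ∫₀^{1/2} ‖Df(a + τ(b − a))‖ₑ² dτ`. [folklore] -/
theorem halfEnergy_le_of_mem_ball {f : E → F} {x₀ a b : E} {r : ℝ} (ha : a ∈ ball x₀ r)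
    (hb : b ∈ ball x₀ r) :
    (‖b - a‖ₑ ^ 2 * ∫⁻ τ in Icc (0 : ℝ) 2⁻¹, ‖fderiv ℝ f (a + τ • (b - a))‖ₑ ^ 2) ≤
      ENNReal.ofReal (4 * r ^ 2) * ∫⁻ τ in Icc (0 : ℝ) 2⁻¹, ‖fderiv ℝ f (a + τ • (b - a))‖ₑ ^ 2 := by
  gcongr
  have hd : ‖b - a‖ < 2 * r := by
    calc ‖b - a‖ = dist b a := (dist_eq_norm b a).symm
      _ ≤ dist b x₀ + dist a x₀ := dist_triangle_right _ _ _
      _ < r + r := add_lt_add (mem_ball.1 hb) (mem_ball.1 ha)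
      _ = 2 * r := by ring
  rw [← ofReal_norm, ← ENNReal.ofReal_pow (norm_nonneg _)]
  exact ENNReal.ofReal_le_ofReal (by nlinarith [norm_nonneg (b - a)])

/-! ### The affine substitution -/

/-- `∫ G(c x + v) dx = |c|⁻ⁿ ∫ G` for `c ≠ 0` (Lebesgue measure: translation invariance and
scaling under homotheties). [folklore] -/
theorem lintegral_comp_smul_add (G : E → ℝ≥0∞) {c : ℝ} (hc : c ≠ 0) (v : E) :
    ∫⁻ x, G (c • x + v) = ENNReal.ofReal |(c ^ finrank ℝ E)⁻¹| * ∫⁻ y, G y := by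
  have h1 : (fun x => G (c • x + v)) = fun x => (fun z => G (c • z)) (x + c⁻¹ • v) := by
    funext x
    simp only [smul_add, smul_smul, mul_inv_cancel₀ hc, one_smul]
  rw [h1, lintegral_add_right_eq_self (fun z => G (c • z)) (c⁻¹ • v)]
  calc ∫⁻ x, G (c • x) = ∫⁻ y, G y ∂(Measure.map (fun x : E => c • x) volume) :=
        (lintegral_map_equiv G
          (Homeomorph.smul (isUnit_iff_ne_zero.2 hc).unit).toMeasurableEquiv).symm
    _ = ENNReal.ofReal |(c ^ finrank ℝ E)⁻¹| * ∫⁻ y, G y := by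
        rw [Measure.map_addHaar_smul volume hc, lintegral_smul_measure, smul_eq_mul]

/-- **Substitution along the segments towards a point of the ball.** For `y ∈ B = B(x₀, r)` and
`0 ≤ τ ≤ 1/2`, `∫_B G(x + τ(y − x)) dx ≤ 2ⁿ ∫_B G`: the map `x ↦ (1 − τ)x + τy` sends `B` into
`B` (convexity) and has Jacobian `(1 − τ)⁻ⁿ ≤ 2ⁿ`. [folklore] -/
theorem setLIntegral_comp_segment_le (G : E → ℝ≥0∞) {x₀ y : E} {r τ : ℝ} (hy : y ∈ ball x₀ r)
    (hτ0 : 0 ≤ τ) (hτ : τ ≤ 2⁻¹) :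
    ∫⁻ x in ball x₀ r, G (x + τ • (y - x)) ≤ 2 ^ finrank ℝ E * ∫⁻ x in ball x₀ r, G x := by
  set S := ball x₀ r with hSdef
  have hS : MeasurableSet S := measurableSet_ball
  have hpos : 0 < 1 - τ := by linarith
  rw [← lintegral_indicator hS, ← lintegral_indicator hS]
  have hpt : ∀ x, S.indicator (fun x => G (x + τ • (y - x))) x ≤
      (S.indicator G) ((1 - τ) • x + τ • y) := by
    intro x
    by_cases hx : x ∈ S
    · rw [indicator_of_mem hx]
      have hmem : (1 - τ) • x + τ • y ∈ S :=
        (convex_ball x₀ r) hx hy hpos.le hτ0 (by ring)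
      rw [indicator_of_mem hmem]
      have : x + τ • (y - x) = (1 - τ) • x + τ • y := by module
      rw [this]
    · rw [indicator_of_notMem hx]
      exact zero_le
  calc ∫⁻ x, S.indicator (fun x => G (x + τ • (y - x))) x
      ≤ ∫⁻ x, (S.indicator G) ((1 - τ) • x + τ • y) := lintegral_mono hpt
    _ = ENNReal.ofReal |((1 - τ) ^ finrank ℝ E)⁻¹| * ∫⁻ x, S.indicator G x :=
        lintegral_comp_smul_add _ hpos.ne' _
    _ ≤ 2 ^ finrank ℝ E * ∫⁻ x, S.indicator G x := by
        gcongr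
        rw [abs_of_pos (by positivity), ← inv_pow]
        calc ENNReal.ofReal ((1 - τ)⁻¹ ^ finrank ℝ E)
            ≤ ENNReal.ofReal (2 ^ finrank ℝ E) := by
              refine ENNReal.ofReal_le_ofReal (pow_le_pow_left₀ (by positivity) ?_ _)
              rw [inv_le_comm₀ hpos two_pos]
              linarith
          _ = 2 ^ finrank ℝ E := by rw [ENNReal.ofReal_pow zero_le_two, ENNReal.ofReal_ofNat]

/-! ### Measurability -/

omit [CompleteSpace F] in
/-- Joint measurability of `((a, b), τ) ↦ ‖Df(a + τ(b − a))‖ₑ²`. [folklore] -/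
theorem measurable_segmentIntegrand {f : E → F} (hf : ContDiff ℝ 1 f) :
    Measurable fun p : (E × E) × ℝ => ‖fderiv ℝ f (p.1.1 + p.2 • (p.1.2 - p.1.1))‖ₑ ^ 2 := by
  have hc : Continuous fun p : (E × E) × ℝ => fderiv ℝ f (p.1.1 + p.2 • (p.1.2 - p.1.1)) :=
    (hf.continuous_fderiv one_ne_zero).comp (by fun_prop)
  exact (hc.measurable.enorm.pow_const 2)

omit [CompleteSpace F] in
/-- Joint measurability of the half-segment energy `(a, b) ↦ T(a, b)`. [folklore] -/
theorem measurable_halfEnergy {f : E → F} (hf : ContDiff ℝ 1 f) :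
    Measurable (uncurry fun a b : E =>
      ‖b - a‖ₑ ^ 2 * ∫⁻ τ in Icc (0 : ℝ) 2⁻¹, ‖fderiv ℝ f (a + τ • (b - a))‖ₑ ^ 2) := by
  have h1 : Measurable fun p : E × E => ‖p.2 - p.1‖ₑ ^ 2 :=
    (continuous_snd.sub continuous_fst).measurable.enorm.pow_const 2
  have h2 : Measurable fun p : E × E =>
      ∫⁻ τ in Icc (0 : ℝ) 2⁻¹, ‖fderiv ℝ f (p.1 + τ • (p.2 - p.1))‖ₑ ^ 2 :=
    (measurable_segmentIntegrand hf).lintegral_prod_right'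
  exact h1.mul h2

/-! ### Jensen: comparison with the mean -/

/-- **Deviation from the mean.** For `f` integrable on a set `S` of finite positive measure and
any point `x`, `‖f(x) − ⨍_S f‖ₑ² ≤ μ(S)⁻¹ ∫_S ‖f(x) − f(y)‖ₑ² dy` (the mean of `f(x) − f(y)` is
`f(x) − f_S`; then Cauchy–Schwarz). [folklore] -/
theorem enorm_sub_setAverage_sq_le {f : E → F} {S : Set E}
    (hS0 : volume S ≠ 0) (hStop : volume S ≠ ⊤) (hint : IntegrableOn f S volume)
    (hmeas : AEStronglyMeasurable f (volume.restrict S)) (x : E) :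
    ‖f x - ⨍ y in S, f y‖ₑ ^ 2 ≤ (volume S)⁻¹ * ∫⁻ y in S, ‖f x - f y‖ₑ ^ 2 := by
  have hc : volume.real S = (volume S).toReal := measureReal_def _ _
  have hcpos : 0 < volume.real S := by rw [hc]; exact ENNReal.toReal_pos hS0 hStop
  have hconst : IntegrableOn (fun _ : E => f x) S volume := integrableOn_const hStop
  have hmean : f x - ⨍ y in S, f y = (volume.real S)⁻¹ • ∫ y in S, (f x - f y) := by
    rw [integral_sub hconst hint, setIntegral_const, setAverage_eq, smul_sub,
      smul_smul, inv_mul_cancel₀ hcpos.ne', one_smul]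
  have hnorm : ‖f x - ⨍ y in S, f y‖ₑ ≤ (volume S)⁻¹ * ∫⁻ y in S, ‖f x - f y‖ₑ := by
    rw [hmean, enorm_smul]
    have hci : ‖(volume.real S)⁻¹‖ₑ = (volume S)⁻¹ := by
      rw [Real.enorm_eq_ofReal (inv_nonneg.2 hcpos.le), ENNReal.ofReal_inv_of_pos hcpos, hc,
        ENNReal.ofReal_toReal hStop]
    rw [hci]
    gcongr
    exact enorm_integral_le_lintegral_enorm _
  have hg : AEMeasurable (fun y => ‖f x - f y‖ₑ) (volume.restrict S) :=
    (aestronglyMeasurable_const.sub hmeas).enorm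
  have hcs := sq_lintegral_le_measure_mul_lintegral_sq (volume.restrict S) hg
  rw [Measure.restrict_apply_univ] at hcs
  calc ‖f x - ⨍ y in S, f y‖ₑ ^ 2 ≤ ((volume S)⁻¹ * ∫⁻ y in S, ‖f x - f y‖ₑ) ^ 2 :=
        pow_le_pow_left' hnorm 2
    _ ≤ (volume S)⁻¹ ^ 2 * (volume S * ∫⁻ y in S, ‖f x - f y‖ₑ ^ 2) := by
        rw [mul_pow]; gcongr
    _ = (volume S)⁻¹ * ∫⁻ y in S, ‖f x - f y‖ₑ ^ 2 := by
        rw [sq, mul_assoc, ← mul_assoc (volume S)⁻¹ (volume S), ENNReal.inv_mul_cancel hS0 hStop,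
          one_mul]

/-! ### The Poincaré inequality -/

/-- **The Poincaré inequality on a ball** (Evans, *PDE*, §5.8.1 Thm. 2; Gilbarg–Trudinger (7.45)).
For `f ∈ C¹(E; F)` on the `n`-dimensional inner product space `E`, every ball `B = B(x₀, r)`,
`r > 0`, and the mean `f_B = ⨍_B f`:
`∫_B ‖f − f_B‖² ≤ 2ⁿ · 4r² · ∫_B ‖Df‖²` (extended-valued; both sides may be computed with the
operator norm of `Df`). [cite: Evans2010, §5.8.1 Thm. 2] -/
theorem lintegral_ball_sub_average_sq_le {f : E → F} (hf : ContDiff ℝ 1 f) (x₀ : E) {r : ℝ}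
    (hr : 0 < r) :
    ∫⁻ x in ball x₀ r, ‖f x - ⨍ y in ball x₀ r, f y‖ₑ ^ 2 ≤
      2 ^ finrank ℝ E * ENNReal.ofReal (4 * r ^ 2) * ∫⁻ x in ball x₀ r, ‖fderiv ℝ f x‖ₑ ^ 2 := by
  set S := ball x₀ r with hSdef
  have hS : MeasurableSet S := measurableSet_ball
  have hS0 : volume S ≠ 0 := (measure_ball_pos volume x₀ hr).ne'
  have hStop : volume S ≠ ⊤ := measure_ball_lt_top.ne
  have hfc : Continuous f := hf.continuous
  have hint : IntegrableOn f S volume :=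
    (hfc.continuousOn.integrableOn_compact (isCompact_closedBall x₀ r)).mono_set
      ball_subset_closedBall
  have hmeas : AEStronglyMeasurable f (volume.restrict S) := hfc.aestronglyMeasurable
  set G : E → ℝ≥0∞ := fun x => ‖fderiv ℝ f x‖ₑ ^ 2 with hGdef
  set T : E → E → ℝ≥0∞ := fun a b =>
    ‖b - a‖ₑ ^ 2 * ∫⁻ τ in Icc (0 : ℝ) 2⁻¹, ‖fderiv ℝ f (a + τ • (b - a))‖ₑ ^ 2 with hTdef
  -- Step 1: Jensen, integrated over `x ∈ S`
  have step1 : ∫⁻ x in S, ‖f x - ⨍ y in S, f y‖ₑ ^ 2 ≤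
      (volume S)⁻¹ * ∫⁻ x in S, ∫⁻ y in S, ‖f x - f y‖ₑ ^ 2 := by
    rw [← lintegral_const_mul' _ _ (ENNReal.inv_ne_top.2 hS0)]
    exact lintegral_mono fun x => enorm_sub_setAverage_sq_le hS0 hStop hint hmeas x
  -- Step 2: the two half segments, and the Tonelli swap of the first term
  have hTm : Measurable (uncurry T) := measurable_halfEnergy hf
  have step2 : ∫⁻ x in S, ∫⁻ y in S, ‖f x - f y‖ₑ ^ 2 ≤
      (∫⁻ a in S, ∫⁻ b in S, T b a) + ∫⁻ a in S, ∫⁻ b in S, T b a := by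
    have hle : ∫⁻ x in S, ∫⁻ y in S, ‖f x - f y‖ₑ ^ 2 ≤
        ∫⁻ x in S, ∫⁻ y in S, (T x y + T y x) :=
      lintegral_mono fun x => lintegral_mono fun y => enorm_sub_sq_le_halfEnergy_add hf x y
    have hsplit : ∀ x, ∫⁻ y in S, (T x y + T y x) = (∫⁻ y in S, T x y) + ∫⁻ y in S, T y x :=
      fun x => lintegral_add_left (hTm.comp measurable_prodMk_left) _
    simp_rw [hsplit] at hle
    have hsplit' : ∫⁻ x in S, ((∫⁻ y in S, T x y) + ∫⁻ y in S, T y x) =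
        (∫⁻ x in S, ∫⁻ y in S, T x y) + ∫⁻ x in S, ∫⁻ y in S, T y x :=
      lintegral_add_left (hTm.lintegral_prod_right') _
    rw [hsplit'] at hle
    have hswap : ∫⁻ x in S, ∫⁻ y in S, T x y = ∫⁻ y in S, ∫⁻ x in S, T x y :=
      lintegral_lintegral_swap hTm.aemeasurable
    rw [hswap] at hle
    exact hle
  -- Step 3: the bound for `J = ∫_a ∫_b T b a`
  have hHm : ∀ a : E, Measurable
      (uncurry fun (b : E) (τ : ℝ) => ‖fderiv ℝ f (b + τ • (a - b))‖ₑ ^ 2) := fun a => by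
    have hc : Continuous fun p : E × ℝ => fderiv ℝ f (p.1 + p.2 • (a - p.1)) :=
      (hf.continuous_fderiv one_ne_zero).comp (by fun_prop)
    exact hc.measurable.enorm.pow_const 2
  have step3 : ∀ a ∈ S, ∫⁻ b in S, T b a ≤
      ENNReal.ofReal (4 * r ^ 2) * (2 ^ finrank ℝ E * (∫⁻ x in S, G x) * 2⁻¹) := by
    intro a ha
    calc ∫⁻ b in S, T b a
        ≤ ∫⁻ b in S, ENNReal.ofReal (4 * r ^ 2) *
            ∫⁻ τ in Icc (0 : ℝ) 2⁻¹, ‖fderiv ℝ f (b + τ • (a - b))‖ₑ ^ 2 :=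
          setLIntegral_mono' hS fun b hb => halfEnergy_le_of_mem_ball hb ha
      _ = ENNReal.ofReal (4 * r ^ 2) *
            ∫⁻ b in S, ∫⁻ τ in Icc (0 : ℝ) 2⁻¹, ‖fderiv ℝ f (b + τ • (a - b))‖ₑ ^ 2 :=
          lintegral_const_mul' _ _ ENNReal.ofReal_ne_top
      _ = ENNReal.ofReal (4 * r ^ 2) *
            ∫⁻ τ in Icc (0 : ℝ) 2⁻¹, ∫⁻ b in S, ‖fderiv ℝ f (b + τ • (a - b))‖ₑ ^ 2 := by
          rw [lintegral_lintegral_swap (hHm a).aemeasurable]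
      _ ≤ ENNReal.ofReal (4 * r ^ 2) *
            ∫⁻ τ in Icc (0 : ℝ) 2⁻¹, 2 ^ finrank ℝ E * ∫⁻ x in S, G x := by
          gcongr ENNReal.ofReal (4 * r ^ 2) * ?_
          exact setLIntegral_mono' measurableSet_Icc fun τ hτ =>
            setLIntegral_comp_segment_le G ha hτ.1 hτ.2
      _ = ENNReal.ofReal (4 * r ^ 2) * (2 ^ finrank ℝ E * (∫⁻ x in S, G x) * 2⁻¹) := by
          rw [setLIntegral_const, Real.volume_Icc, sub_zero, ENNReal.ofReal_inv_of_pos two_pos,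
            ENNReal.ofReal_ofNat]
  have step3' : ∫⁻ a in S, ∫⁻ b in S, T b a ≤
      ENNReal.ofReal (4 * r ^ 2) * (2 ^ finrank ℝ E * (∫⁻ x in S, G x) * 2⁻¹) * volume S := by
    calc ∫⁻ a in S, ∫⁻ b in S, T b a
        ≤ ∫⁻ a in S, ENNReal.ofReal (4 * r ^ 2) * (2 ^ finrank ℝ E * (∫⁻ x in S, G x) * 2⁻¹) :=
          setLIntegral_mono' hS step3
      _ = _ := setLIntegral_const _ _
  -- Step 4: assemble
  set K : ℝ≥0∞ := ENNReal.ofReal (4 * r ^ 2) * (2 ^ finrank ℝ E * (∫⁻ x in S, G x) * 2⁻¹)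
    with hK
  calc ∫⁻ x in S, ‖f x - ⨍ y in S, f y‖ₑ ^ 2
      ≤ (volume S)⁻¹ * ∫⁻ x in S, ∫⁻ y in S, ‖f x - f y‖ₑ ^ 2 := step1
    _ ≤ (volume S)⁻¹ * (K * volume S + K * volume S) := by gcongr; exact step2.trans (add_le_add step3' step3')
    _ = K + K := by
        rw [← add_mul, mul_comm (K + K) (volume S), ← mul_assoc, ENNReal.inv_mul_cancel hS0 hStop,
          one_mul]
    _ = 2 ^ finrank ℝ E * ENNReal.ofReal (4 * r ^ 2) * ∫⁻ x in S, G x := by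
        have h2 : (2 : ℝ≥0∞) * 2⁻¹ = 1 := ENNReal.mul_inv_cancel two_ne_zero ENNReal.ofNat_ne_top
        calc K + K = (2 * 2⁻¹) * (2 ^ finrank ℝ E * ENNReal.ofReal (4 * r ^ 2) * ∫⁻ x in S, G x) := by
              rw [hK]; ring
          _ = _ := by rw [h2, one_mul]

end PoincareBall

end Literature.Analysis.FluidPDE

end
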